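import Mathlib
import Literature.Analysis.Calculus.NewtonKantorovichHolds

/-!
# Sketch — crux-ideate r1 k3 for `SkeletonJ1R` (stmt-NavierStokesRegularity-23610)
# Card `free-tail-slice-newton`: FREE TAILS ⇒ right inverse by clamped waist shooting ⇒ Newton–Kantorovich ON THE SLICE

Both first-lemma statements of the card are stated AND PROVED here (0 sorries):

* `ClampedShootingBound` / `clampedShootingBound_holds` — the model a-priori estimate behind the Γ-free gain `2ℓ²/β`
  of the clamped (waist-shot) low-band right inverse on a tangency interval of length `ℓ` (no boundary-value problem, no
  collar, no pinning): a `C²` field `Y` with `Y(c) = Y′(c) = 0` solving `β•Y″ = f − w•Y′ + S·Y` on `[c, c+ℓ]` with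
  `|w| ≤ W`, `‖S‖ ≤ σ`, `‖f‖ ≤ M` and `Wℓ + σℓ² ≤ β/2` obeys `‖Y‖ ≤ 2ℓ²M/β`.  (In the crux's units `ℓ ≍ Rb√(Γ log Γ)`,
  `β = Γ|γ| log Γ/(8π)`, `W ≲ 3ℓ`, `σ = sup‖S_⊥‖ + sup‖B‖ = O(1)`: the smallness hypothesis reads `8πRb²·O(1)/|γ| ≤ 1/2`,
  Γ-FREE — the regime `Rb ≤ Rb₁` of the landed frame stub `LiaFrameExistsL`.)  Vector-valued, so the coupled N-filament
  system (`V = (ℝ²)ᴺ`, coupling `B` inside `S`, complex structure `J` absorbed into `f, w, S`) is the same statement.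
* `SliceKantorovich` / `sliceKantorovich_holds` — Newton–Kantorovich ON A SLICE: if `R` is a bounded RIGHT inverse of
  `G′(x₀)` (`G′(x₀) ∘ R = id`), the composed map `g ↦ G(x₀ + R g)` has derivative `id` at `0`, and the LANDED affine
  covariant theorem `Literature.Analysis.Calculus.NewtonKantorovich_holds` (two-sided inverse `G := id` in
  `KantorovichData`) yields a zero `x₀ + R g⋆`, `‖g⋆‖ ≤ ρ₋ = (1 − √(1 − 2αω))/ω`, from `h = αω ≤ 1/2` — injectivity of
  `G′(x₀)` is never needed.  (Equivalently Deuflhard Thm 4.7 with `κ = 0`: `gaussNewtonOuter_rate/_converges`.)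

HONEST FRAMING: an ODE lemma and an abstract Banach-space lemma for a line on the ∃-side deciding crux of a HYPOTHETICAL
filament skeleton (negative-side MODEL route); nothing here bears on Navier–Stokes regularity; 23610/23320/23612 stay OPEN.
-/

set_option linter.dupNamespace false

open Set Metric Filter Topology

namespace Summit.NavierStokesRegularity.NavierStokesRegularity.Cruxes.SkeletonJ1R.FreeTailSliceNewton


def ClampedShootingBound : Prop :=
  ∀ (V : Type) [NormedAddCommGroup V] [NormedSpace ℝ V]
    (β ℓ c W σ M : ℝ) (w : ℝ → ℝ) (S : ℝ → V →L[ℝ] V) (f Y Y' Y'' : ℝ → V),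
    0 < β → 0 < ℓ → 0 ≤ M →
    (∀ t ∈ Icc c (c + ℓ), HasDerivAt Y (Y' t) t ∧ HasDerivAt Y' (Y'' t) t ∧
        β • Y'' t = f t - w t • Y' t + S t (Y t) ∧ |w t| ≤ W ∧ ‖S t‖ ≤ σ ∧ ‖f t‖ ≤ M) →
    Y c = 0 → Y' c = 0 →
    W * ℓ + σ * ℓ ^ 2 ≤ β / 2 →
    ∀ t ∈ Icc c (c + ℓ), ‖Y t‖ ≤ 2 * ℓ ^ 2 * M / β

/-- The clamped (waist-shot) sweep has the Γ-free gain `2ℓ²/β`: brute Grönwall on a sub-wavelength interval. -/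
theorem clampedShootingBound_holds : ClampedShootingBound := by
  intro V _ _ β ℓ c W σ M w S f Y Y' Y'' hβ hℓ hM hode hYc hY'c hsmall t ht
  have hcℓ : c ≤ c + ℓ := by linarith
  -- continuity of Y' on the interval and its maximum A
  have hcontY' : ContinuousOn (fun s => ‖Y' s‖) (Icc c (c + ℓ)) := fun s hs =>
    ((hode s hs).2.1).continuousAt.continuousWithinAt.norm
  obtain ⟨s₁, hs₁, hmax⟩ :=
    (isCompact_Icc (a := c) (b := c + ℓ)).exists_isMaxOn (nonempty_Icc.2 hcℓ) hcontY'
  set A := ‖Y' s₁‖ with hA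
  have hA_bound : ∀ s ∈ Icc c (c + ℓ), ‖Y' s‖ ≤ A := fun s hs => hmax hs
  have hA0 : 0 ≤ A := norm_nonneg _
  -- nonnegativity of W and σ (from the pointwise bounds at c)
  have hW0 : 0 ≤ W := (abs_nonneg _).trans (hode c (left_mem_Icc.2 hcℓ)).2.2.2.1
  have hσ0 : 0 ≤ σ := (norm_nonneg _).trans (hode c (left_mem_Icc.2 hcℓ)).2.2.2.2.1
  -- ‖Y s‖ ≤ ℓ A by the mean value inequality from the clamp Y c = 0
  have hYle : ∀ s ∈ Icc c (c + ℓ), ‖Y s‖ ≤ ℓ * A := by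
    intro s hs
    have hmvt := norm_image_sub_le_of_norm_deriv_le_segment' (f := Y) (f' := Y') (a := c) (b := c + ℓ)
      (C := A) (fun x hx => (hode x hx).1.hasDerivWithinAt) (fun x hx => hA_bound x (Ico_subset_Icc_self hx)) s hs
    rw [hYc, sub_zero] at hmvt
    calc ‖Y s‖ ≤ A * (s - c) := hmvt
      _ ≤ A * ℓ := mul_le_mul_of_nonneg_left (by linarith [hs.2]) hA0
      _ = ℓ * A := mul_comm _ _
  -- ‖Y'' s‖ ≤ (M + W A + σ ℓ A)/β from the equation
  have hY''le : ∀ s ∈ Icc c (c + ℓ), ‖Y'' s‖ ≤ (M + W * A + σ * (ℓ * A)) / β := by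
    intro s hs
    obtain ⟨-, -, hEq, hw, hS, hf⟩ := hode s hs
    have hY'' : Y'' s = β⁻¹ • (f s - w s • Y' s + S s (Y s)) := by
      rw [← hEq, smul_smul, inv_mul_cancel₀ hβ.ne', one_smul]
    rw [hY'', norm_smul, norm_inv, Real.norm_eq_abs, abs_of_pos hβ, div_eq_inv_mul]
    refine mul_le_mul_of_nonneg_left ?_ (inv_nonneg.2 hβ.le)
    calc ‖f s - w s • Y' s + S s (Y s)‖ ≤ ‖f s - w s • Y' s‖ + ‖S s (Y s)‖ := norm_add_le _ _
      _ ≤ (‖f s‖ + ‖w s • Y' s‖) + ‖S s (Y s)‖ := by gcongr; exact norm_sub_le _ _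
      _ ≤ (M + W * A) + σ * (ℓ * A) := by
          have h2 : ‖w s • Y' s‖ ≤ W * A := by
            rw [norm_smul, Real.norm_eq_abs]
            exact mul_le_mul hw (hA_bound s hs) (norm_nonneg _) hW0
          have h3 : ‖S s (Y s)‖ ≤ σ * (ℓ * A) :=
            (ContinuousLinearMap.le_opNorm _ _).trans
              (mul_le_mul hS (hYle s hs) (norm_nonneg _) hσ0)
          exact add_le_add (add_le_add hf h2) h3
  -- ‖Y' s₁‖ ≤ ℓ (M + W A + σ ℓ A)/β by the mean value inequality from the clamp Y' c = 0
  have hK0 : 0 ≤ (M + W * A + σ * (ℓ * A)) / β := by positivity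
  have hAle : A ≤ ℓ * ((M + W * A + σ * (ℓ * A)) / β) := by
    have hmvt := norm_image_sub_le_of_norm_deriv_le_segment' (f := Y') (f' := Y'') (a := c) (b := c + ℓ)
      (C := (M + W * A + σ * (ℓ * A)) / β) (fun x hx => (hode x hx).2.1.hasDerivWithinAt)
      (fun x hx => hY''le x (Ico_subset_Icc_self hx)) s₁ hs₁
    rw [hY'c, sub_zero] at hmvt
    calc A = ‖Y' s₁‖ := hA
      _ ≤ (M + W * A + σ * (ℓ * A)) / β * (s₁ - c) := hmvt
      _ ≤ (M + W * A + σ * (ℓ * A)) / β * ℓ := mul_le_mul_of_nonneg_left (by linarith [hs₁.2]) hK0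
      _ = ℓ * ((M + W * A + σ * (ℓ * A)) / β) := mul_comm _ _
  -- absorb: A β ≤ ℓ M + A (W ℓ + σ ℓ²) ≤ ℓ M + A β / 2
  have hAβ : A * β ≤ ℓ * M + A * (W * ℓ + σ * ℓ ^ 2) := by
    have : A ≤ (ℓ * (M + W * A + σ * (ℓ * A))) / β := by rwa [mul_div_assoc]
    have h2 := (le_div_iff₀ hβ).1 this
    nlinarith [h2]
  have hA2 : A * (W * ℓ + σ * ℓ ^ 2) ≤ A * (β / 2) := mul_le_mul_of_nonneg_left hsmall hA0
  have hAfin : A ≤ 2 * ℓ * M / β := by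
    rw [le_div_iff₀ hβ]
    nlinarith [hAβ, hA2]
  -- conclude
  calc ‖Y t‖ ≤ ℓ * A := hYle t ht
    _ ≤ ℓ * (2 * ℓ * M / β) := mul_le_mul_of_nonneg_left hAfin hℓ.le
    _ = 2 * ℓ ^ 2 * M / β := by ring


/-- GLUE LEMMA (K♭), restated locally for the proof file. -/
def SliceKantorovich : Prop :=
  ∀ (E F : Type) [NormedAddCommGroup E] [NormedSpace ℝ E] [CompleteSpace E]
    [NormedAddCommGroup F] [NormedSpace ℝ F] [CompleteSpace F]
    (G : E → F) (G' : E → E →L[ℝ] F) (D : Set E) (x₀ : E) (R : F →L[ℝ] E) (α ω : ℝ),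
    IsOpen D → Convex ℝ D → x₀ ∈ D →
    (∀ x ∈ D, HasFDerivAt G (G' x) x) → ContinuousOn G' D →
    (G' x₀).comp R = ContinuousLinearMap.id ℝ F →
    ‖G x₀‖ ≤ α → 0 < ω → α * ω ≤ 1 / 2 →
    (∀ u v : F, x₀ + R u ∈ D → x₀ + R v ∈ D →
        ‖((G' (x₀ + R u)) - (G' (x₀ + R v))).comp R‖ ≤ ω * ‖u - v‖) →
    (∀ g : F, ‖g‖ ≤ (1 - Real.sqrt (1 - 2 * (α * ω))) / ω → x₀ + R g ∈ D) →
    ∃ g : F, ‖g‖ ≤ (1 - Real.sqrt (1 - 2 * (α * ω))) / ω ∧ G (x₀ + R g) = 0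

/-- **Kantorovich on the slice is an instance of the landed affine-covariant Newton–Kantorovich theorem**
(`Literature.Analysis.Calculus.NewtonKantorovich_holds`) applied to `g ↦ G (x₀ + R g)` with the two-sided inverse `id`. -/
theorem sliceKantorovich_holds : SliceKantorovich := by
  intro E F _ _ _ _ _ _ G G' D x₀ R α ω hDo hDc hx₀ hGd hGc hR hα hω hh hlip hball
  -- the slice parametrisation `ι g = x₀ + R g` and the composed map
  have hι_cont : Continuous (fun g : F => x₀ + R g) := continuous_const.add R.continuous
  have hι_deriv : ∀ g : F, HasFDerivAt (fun g : F => x₀ + R g) R g := fun g =>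
    (R.hasFDerivAt).const_add x₀
  have hDt_open : IsOpen ((fun g : F => x₀ + R g) ⁻¹' D) := hDo.preimage hι_cont
  have hDt_convex : Convex ℝ ((fun g : F => x₀ + R g) ⁻¹' D) := by
    intro a ha b hb s t hs ht hst
    show x₀ + R (s • a + t • b) ∈ D
    have hx : (s + t) • x₀ = x₀ := by rw [hst, one_smul]
    have : x₀ + R (s • a + t • b) = s • (x₀ + R a) + t • (x₀ + R b) := by
      rw [map_add, map_smul, map_smul, smul_add, smul_add]
      nth_rewrite 1 [← hx]
      rw [add_smul]; abel
    rw [this]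
    exact hDc ha hb hs ht hst
  have h0mem : (0 : F) ∈ ((fun g : F => x₀ + R g) ⁻¹' D) := by
    show x₀ + R 0 ∈ D
    simpa using hx₀
  have hF'0 : (G' (x₀ + R 0)).comp R = ContinuousLinearMap.id ℝ F := by
    simpa using hR
  -- bundle the data
  let d : Literature.Analysis.Calculus.KantorovichData F F :=
    { F := fun g => G (x₀ + R g)
      F' := fun g => (G' (x₀ + R g)).comp R
      D := (fun g : F => x₀ + R g) ⁻¹' D
      x0 := 0
      G := ContinuousLinearMap.id ℝ F
      α := α
      ω := ω
      isOpen_D := hDt_open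
      convex_D := hDt_convex
      x0_mem := h0mem
      hasFDerivAt := by
        intro g hg
        exact (hGd (x₀ + R g) hg).comp g (hι_deriv g)
      continuousOn_F' := by
        have h1 : ContinuousOn (fun g : F => G' (x₀ + R g)) ((fun g : F => x₀ + R g) ⁻¹' D) :=
          hGc.comp hι_cont.continuousOn (fun g hg => hg)
        exact h1.clm_comp continuousOn_const
      G_left := by
        intro v
        have := congrArg (fun T : F →L[ℝ] F => T v) hF'0
        simpa using this
      G_right := by
        intro w
        have := congrArg (fun T : F →L[ℝ] F => T w) hF'0
        simpa using this
      norm_G_F_le := by simpa using hα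
      lipschitz := by
        intro u hu v hv
        have hu' : x₀ + R u ∈ D := hu
        have hv' : x₀ + R v ∈ D := hv
        have := hlip v u hv' hu'
        simpa [ContinuousLinearMap.sub_comp] using this
      ω_pos := hω
      h0_le := hh }
  have hballD : closedBall d.x0 d.rhoMinus ⊆ d.D := by
    intro g hg
    have hg' : ‖g‖ ≤ (1 - Real.sqrt (1 - 2 * (α * ω))) / ω := by
      have := hg
      rw [mem_closedBall, dist_zero_right] at this
      exact this
    exact hball g hg'
  obtain ⟨_, _, _, xstar, hxmem, hzero, _⟩ :=
    Literature.Analysis.Calculus.NewtonKantorovich_holds F F d hballD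
  refine ⟨xstar, ?_, hzero⟩
  have := hxmem
  rw [mem_closedBall, dist_zero_right] at this
  exact this

end Summit.NavierStokesRegularity.NavierStokesRegularity.Cruxes.SkeletonJ1R.FreeTailSliceNewton
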